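import Summits.HodgeConjecture.CorCM.MumfordTateRankEqHodgeLieRankAddOne
import Literature.AlgebraicGeometry.Motives.HodgeLieOfAbelianVarietyMultiplicities
import HarnessLib

/-!
# `dim MT(H¹X)` depends only on the set of factors: `t(X) = t(X')` for `X ∼ ⨁_{(i,k)} B_i`, `X' ∼ ⨁_i B_i`

COR-CM (cell `pub-hodgecm2`, seat `b27` gen 43, count-neutral Mumford–Tate-rank ladder; theorems only, no definition, no
named fact; UNCONDITIONAL — nothing here uses or asserts HC_CM).  The Mumford–Tate-rank form of
`Motives/HodgeLieOfAbelianVarietyMultiplicities` (`dim Lie Hg(H¹(⨁_{(i,k)} B_i)) = dim Lie Hg(H¹(⨁_i B_i))`, Moonen–Zarhin 1999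
§1: `Hg(∏ B_i^{n_i}) = Hg(∏ B_i)` acting diagonally) with `dim MT = dim Lie Hg + 1` (`mtRank_hodge_one_eq_finrank_hodgeLie_add_one`):
the rungs of the ladder are statements about the SET of simple factors.  Generalises `CorCM/MumfordTateRankOfPowers` (one
factor, gen 42).

* **`mtRank_hodge_one_eq_of_isIsogenous_biproduct_sigma`** — `t(X) = t(X')` for `X ∼ ⨁_{(i,k) : Σ i, m_i} B_i` and
  `X' ∼ ⨁_i B_i` (`m_i` nonempty finite, `0 < dim B_i` for some `i`).

## References
* [MoonenZarhin1999LowDim] B. Moonen, Yu. Zarhin, Math. Ann. 315 (1999), §1 [corpus: paper:arxiv-math_9901113 p. 2].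
* [Moonen1999MTNotes] B. Moonen, *Notes on Mumford–Tate groups* (1999), (1.8).
* [Deligne1982HodgeCycles] P. Deligne, LNM 900 (1982), I §3.1 and Prop. 3.4.
-/

noncomputable section

open CategoryTheory CategoryTheory.Limits Module

namespace Summit.HodgeConjecture.CorCM

open Literature.AlgebraicGeometry.Motives
open Literature.AlgebraicGeometry.Motives.AbelianVariety
open Literature.AlgebraicGeometry.Motives.HodgeStructure
open Literature.AlgebraicGeometry.HodgeTheory

variable [HodgeTensorFacts.{0, 0}]
  {ι : Type} [Fintype ι] [DecidableEq ι] {m : ι → Type} [∀ i, Fintype (m i)] [∀ i, DecidableEq (m i)]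
  [∀ i, Nonempty (m i)] {B : ι → AbelianVariety ℂ}

/-- **`t(X) = t(X')` for `X ∼ ⨁_{(i,k)} B_i` and `X' ∼ ⨁_i B_i`** (`0 < dim X'`): the Mumford–Tate rank of `H¹` depends
only on the set of factors, not on their multiplicities (`Hg(∏ B_i^{n_i}) = Hg(∏ B_i)`;
`AbelianVariety.finrank_hodgeLie_hodge_one_eq_of_isIsogenous_biproduct_sigma` and `dim MT = dim Lie Hg + 1` on both sides).
[cite: MoonenZarhin1999LowDim, §1] [cite: Moonen1999MTNotes, (1.8)] [cite: Deligne1982HodgeCycles, I §3.1 and Prop. 3.4] -/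
theorem mtRank_hodge_one_eq_of_isIsogenous_biproduct_sigma {X X' : AbelianVariety ℂ} {n n' : ℕ}
    (hX : IsSmoothProjective n X.X) (hX' : IsSmoothProjective n' X'.X) (h0 : 0 < X.dim) (h0' : 0 < X'.dim)
    (h : IsIsogenous X (⨁ fun p : Σ i, m i => B p.1)) (h' : IsIsogenous X' (⨁ B)) :
    haveI := BettiUniverse.finite hX 1
    haveI := BettiUniverse.finite hX' 1
    (BettiUniverse.hodge exists_isReal_hodgeModel_holds hX 1).mtRank =
      (BettiUniverse.hodge exists_isReal_hodgeModel_holds hX' 1).mtRank := by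
  haveI := BettiUniverse.finite hX 1
  haveI := BettiUniverse.finite hX' 1
  rw [mtRank_hodge_one_eq_finrank_hodgeLie_add_one hX h0, mtRank_hodge_one_eq_finrank_hodgeLie_add_one hX' h0',
    AbelianVariety.finrank_hodgeLie_hodge_one_eq_of_isIsogenous_biproduct_sigma
      (fun i => AbelianVariety.isSmoothProjective_holds (A := B i)) hX hX' h h']

end Summit.HodgeConjecture.CorCM

end
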